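import Summits.HubbardSuperconductivity.HubbardSuperconductivity.Theorems.CwThesis.Negative.FreeEndpointLevelSet
import Summits.HubbardSuperconductivity.HubbardSuperconductivity.Theorems.CwThesis.Negative.FreeEndpointPairBound
import Literature.MathematicalPhysics.QuantumLattice.HubbardRingPerronFrobeniusProofs
import Literature.MathematicalPhysics.QuantumLattice.FinDimSpectrumSectorGibbsLimit
import Literature.MathematicalPhysics.QuantumLattice.DopedRVBState
import Literature.MathematicalPhysics.QuantumLattice.PairedProductStates
import Summits.HubbardSuperconductivity.HubbardSuperconductivity.Theorems.ThermalWedgeTwTipContinuationEdgeOrderPairAlgebra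

/-!
# Crux `CwThesis` (item `stmt-HubbardSuperconductivity-10438`, route ChiralWindow): the FREE ENDPOINT —
# every sector ground state of the free torus has a sharp Fermi step, hence `O(L²)` pair intensity

Negative-side support of the standing disprover (generation 1; workfile `Cruxes/CwThesis/Disproof.lean`), file 3 of
the free-endpoint programme (file 1 `FreeEndpointLevelSet`: level sets of the band have `≤ 2L` points; file 2
`FreeEndpointPairBound`: a unit vector with a sharp spin-`↑` Fermi step has pair intensity
`≤ 8(8L² + 2(2·#{ε_L = μ})²)`). Main results:

* `fermiStep_of_isGroundStateInSector` — for `L ≥ 3`, EVERY normalised ground state `ψ` of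
  `H₀ = hubbardTorus 2 L 1 0 = Σ_{kσ} ε_L(k) n_{kσ}` (`hubbardTorus_zero_eq_sum_momentumNumber`) in a sector
  `(2n, S^z = 0)` has a Fermi level `μ` with `c_{k↑} ψ = 0` above and `c†_{k↑} ψ = 0` below: the per-mode slacks
  `(ε_k-μ) re⟨n_{kσ}⟩ - min(ε_k-μ,0)‖·‖²` are nonnegative and sum to `re⟨H₀⟩ - μ re⟨N⟩ - E₀(μ)‖·‖²`; they vanish on
  the pair-filled aufbau vector `Π_{k∈F} b†_k|0⟩` of the sector (the paired-product-state calculus of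
  `Literature/…/PairedProductStates.lean`), so by the variational minimality of the sector energy
  (`minEnergyOn_le_rayleigh_of_mem`) they vanish on `ψ` — aufbau by an operator inequality, no Wick theorem;
* `free_pairIntensity_le` — hence `re⟨ψ, P†P ψ⟩ ≤ 320 L²`, `P = pairField dWaveFormFactor L` (`= √2 Δ_d`), for every
  such `ψ`: at `U = 0` the summit's matrix fails for every doping and the `U ∈ [0, U₀)` variant of `CwThesis` is
  false (corollaries in `FreeEndpointCorollaries.lean`).

Folklore (aufbau principle; BCS 1957 §II for the product calculus). No definitions; nothing asserts a Theses
declaration.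
-/

noncomputable section

namespace Summit.HubbardSuperconductivity.CwThesis.Negative

open Matrix Finset Real Literature.MathematicalPhysics.QuantumLattice Literature.Probability.LatticeModels
open scoped ComplexOrder ComplexConjugate

/-! ## The aufbau state and the Fermi step of every free sector ground state -/

section Aufbau

open Summit.HubbardSuperconductivity.TwTipContinuation.IsogapTransport

variable {L : ℕ} [NeZero L]

/-- The pair-filled aufbau vector `Φ_l = Π_{k ∈ l} b†_k |0⟩` (local notation for the literal term, exactly as in
`Literature/…/PairedProductStates.lean`, whose calculus — `star_pairedState_dotProduct_self`,
`momentumNumber_{up,down}_pairedState_of_{mem,not_mem}` — is used below). -/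
local notation "Φ[" l "]" =>
  (List.prod (List.map (fun k => (pairMode k)ᴴ) l) *ᵥ (vacuum : Fock (Orb (FermionTorus 2 _))))

/-- `Φ_l` lies in the sector `(N↑, N↓) = (|l|, |l|)`. [folklore] -/
theorem aufbau_isInSector (l : List (TorusSite 2 L)) : IsInSector l.length l.length (Φ[l]) := by
  induction l with
  | nil =>
    simpa only [List.map_nil, List.prod_nil, one_mulVec, List.length_nil] using
      (IsInSector.vacuum : IsInSector 0 0 (vacuum : Fock (Orb (FermionTorus 2 L))))
  | cons k l ih =>
    rw [List.map_cons, List.prod_cons, ← mulVec_mulVec, pairMode_conjTranspose, List.length_cons]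
    exact isInSector_pairCreator_mulVec k (-k) ih

/-! ### A Fermi level for `n` levels per spin, and the aufbau set -/

/-- **A Fermi level exists**: for `n ≤ L²` there is `μ` with `#{ε < μ} ≤ n ≤ #{ε ≤ μ}` (take `μ` the least
level whose closed lower set has at least `n` points). [folklore] -/
theorem exists_fermiLevel (ε : TorusSite 2 L → ℝ) {n : ℕ} (hn : n ≤ Fintype.card (TorusSite 2 L)) :
    ∃ μ : ℝ, (univ.filter fun k => ε k < μ).card ≤ n ∧ n ≤ (univ.filter fun k => ε k ≤ μ).card := by
  classical
  set A := univ.filter fun k : TorusSite 2 L => n ≤ (univ.filter fun j => ε j ≤ ε k).card with hA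
  have hAne : A.Nonempty := by
    obtain ⟨k₀, -, hk₀⟩ := Finset.exists_max_image univ ε univ_nonempty
    refine ⟨k₀, ?_⟩
    rw [hA, mem_filter]
    refine ⟨mem_univ _, ?_⟩
    have : (univ.filter fun j => ε j ≤ ε k₀) = univ := by
      ext j
      simp only [mem_filter, mem_univ, true_and, iff_true]
      exact hk₀ j (mem_univ j)
    rw [this, card_univ]
    exact hn
  obtain ⟨kstar, hkA, hmin⟩ := Finset.exists_min_image A ε hAne
  refine ⟨ε kstar, ?_, ?_⟩
  · by_contra hlt
    push Not at hlt
    have hne : (univ.filter fun k => ε k < ε kstar).Nonempty := by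
      rw [← Finset.card_pos]; omega
    obtain ⟨j₀, hj₀, hj₀max⟩ := Finset.exists_max_image _ ε hne
    rw [mem_filter] at hj₀
    have hsub : (univ.filter fun k => ε k < ε kstar) ⊆ (univ.filter fun j => ε j ≤ ε j₀) := by
      intro k hk
      rw [mem_filter] at hk ⊢
      exact ⟨mem_univ _, hj₀max k (by rw [mem_filter]; exact hk)⟩
    have hj₀A : j₀ ∈ A := by
      rw [hA, mem_filter]
      exact ⟨mem_univ _, le_trans hlt.le (card_le_card hsub)⟩
    have := hmin j₀ hj₀A
    linarith [hj₀.2]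
  · rw [hA, mem_filter] at hkA
    exact hkA.2

/-- **The aufbau set**: `n ≤ L²` levels can be chosen containing every level strictly below a Fermi level `μ`
and none strictly above it. [folklore] -/
theorem exists_aufbauSet (ε : TorusSite 2 L → ℝ) {n : ℕ} (hn : n ≤ Fintype.card (TorusSite 2 L)) :
    ∃ (μ : ℝ) (F : Finset (TorusSite 2 L)),
      (∀ k, ε k < μ → k ∈ F) ∧ (∀ k ∈ F, ε k ≤ μ) ∧ F.card = n := by
  classical
  obtain ⟨μ, h1, h2⟩ := exists_fermiLevel ε hn
  have hst : (univ.filter fun k => ε k < μ) ⊆ (univ.filter fun k => ε k ≤ μ) := fun k hk => by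
    rw [mem_filter] at hk ⊢
    exact ⟨hk.1, hk.2.le⟩
  obtain ⟨F, hBF, hFS, hcard⟩ := Finset.exists_subsuperset_card_eq hst h1 h2
  refine ⟨μ, F, fun k hk => hBF (by rw [mem_filter]; exact ⟨mem_univ _, hk⟩), fun k hk => ?_, hcard⟩
  have := hFS hk
  rw [mem_filter] at this
  exact this.2

/-! ### Every free sector ground state has a sharp `↑` Fermi step -/

omit [NeZero L] in
/-- `‖v‖ = 0 → v = 0` for the Euclidean norm. [folklore] -/
theorem eq_zero_of_eucNorm_sq_eq_zero {v : Fock (Orb (FermionTorus 2 L))} (h : eucNorm v ^ 2 = 0) : v = 0 := by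
  have h2 : star v ⬝ᵥ v = 0 := by
    rw [star_dotProduct_self_eq_eucNorm_sq, h, Complex.ofReal_zero]
  exact dotProduct_star_self_eq_zero.1 h2

/-- **The Fermi step of a free sector ground state** (aufbau by an operator inequality). For `L ≥ 3` and a
normalised ground state `ψ` of the free torus `H₀ = hubbardTorus 2 L 1 0 = Σ_{kσ} ε_L(k) n_{kσ}` in the sector
`(2n, S^z = 0)` there is a Fermi level `μ` such that `c_{k↑} ψ = 0` for `ε_L(k) > μ` and `c†_{k↑} ψ = 0` for
`ε_L(k) < μ`. Proof: the per-mode slacks `τ_{kσ}(φ) = (ε_k-μ) re⟨φ,n_{kσ}φ⟩ - min(ε_k-μ,0)‖φ‖²` are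
nonnegative (`n`, `1-n` are squares of contractions) and sum to `re⟨φ,H₀φ⟩ - μ re⟨φ,Nφ⟩ - E₀(μ)‖φ‖²`; they all
vanish on the aufbau vector `Φ` of the sector (levels `< μ` filled, a subset of the level set `= μ` filled to
reach `n`), so by minimality `E* ≤ re⟨Φ,H₀Φ⟩` they sum to `≤ 0` on `ψ`, hence vanish termwise. [folklore] -/
theorem fermiStep_of_isGroundStateInSector (hL : 3 ≤ L) {n : ℕ} {ψ : Fock (Orb (FermionTorus 2 L))}
    (hψ : IsGroundStateInSector (hubbardTorus 2 L 1 0) (2 * n) 0 ψ) (hψ1 : star ψ ⬝ᵥ ψ = 1) :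
    ∃ μ : ℝ, (∀ k, μ < torusBand L k → momentumAnnihilation k 0 *ᵥ ψ = 0) ∧
      (∀ k, torusBand L k < μ → momentumCreation k 0 *ᵥ ψ = 0) := by
  classical
  have hmem := hψ.1
  have hne0 := hψ.2.1
  have hHψ := hψ.2.2
  have hsec : IsInSector n n ψ := (mem_szSector_two_mul_zero_iff n ψ).1 hmem
  -- `n ≤ L²`: some configuration with `n` up-electrons carries `ψ`
  have hn : n ≤ Fintype.card (TorusSite 2 L) := by
    obtain ⟨s, hs⟩ : ∃ s, ψ s ≠ 0 := by
      by_contra h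
      push Not at h
      exact hne0 (funext h)
    have hcard : (upPart s).card = n := by
      by_contra hc
      exact hs (hsec s (fun h => hc h.1))
    calc n = (upPart s).card := hcard.symm
      _ ≤ Fintype.card (FermionTorus 2 L) := Finset.card_le_univ _
      _ = Fintype.card (TorusSite 2 L) := Fintype.card_congr FermionTorus.equivTorusSite
  obtain ⟨μ, F, hBF, hFS, hFcard⟩ := exists_aufbauSet (torusBand L) hn
  -- the aufbau vector on `F`
  set l := F.toList with hl
  have hlnd : l.Nodup := F.nodup_toList
  have hlmem : ∀ k, k ∈ l ↔ k ∈ F := fun k => Finset.mem_toList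
  have hllen : l.length = n := by rw [hl, Finset.length_toList, hFcard]
  have hΦ1 : star (Φ[l]) ⬝ᵥ Φ[l] = 1 := star_pairedState_dotProduct_self hlnd
  have hΦsec : IsInSector n n (Φ[l]) := by
    have := aufbau_isInSector l
    rwa [hllen] at this
  have hΦmem : Φ[l] ∈ szSector (2 * n) (0:ℝ) := (mem_szSector_two_mul_zero_iff n _).2 hΦsec
  -- the slack of a vector at a mode
  set τ : Fock (Orb (FermionTorus 2 L)) → TorusSite 2 L → Fin 2 → ℝ := fun φ k σ =>
    (torusBand L k - μ) * (star φ ⬝ᵥ (momentumNumber k σ *ᵥ φ)).re -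
      min (torusBand L k - μ) 0 * eucNorm φ ^ 2 with hτ
  have hτ_nonneg : ∀ φ k σ, 0 ≤ τ φ k σ := by
    intro φ k σ
    simp only [hτ]
    rcases le_or_gt 0 (torusBand L k - μ) with h | h
    · rw [min_eq_right h, zero_mul, sub_zero, re_expect_momentumNumber]
      exact mul_nonneg h (sq_nonneg _)
    · rw [min_eq_left h.le]
      have := eucNorm_sq_sub_re_expect_momentumNumber k σ φ
      nlinarith [sq_nonneg (eucNorm (momentumCreation k σ *ᵥ φ))]
  -- the sum of the slacks
  have hH : ∀ φ : Fock (Orb (FermionTorus 2 L)), (star φ ⬝ᵥ (hubbardTorus 2 L 1 0 *ᵥ φ)).re =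
      ∑ k : TorusSite 2 L, ∑ σ : Fin 2, torusBand L k * (star φ ⬝ᵥ (momentumNumber k σ *ᵥ φ)).re := by
    intro φ
    rw [hubbardTorus_zero_eq_sum_momentumNumber hL]
    simp only [sum_mulVec, smul_mulVec, dotProduct_sum, dotProduct_smul, Complex.re_sum, smul_eq_mul,
      Complex.re_ofReal_mul]
  have hN : ∀ φ : Fock (Orb (FermionTorus 2 L)), (star φ ⬝ᵥ (totalNumber *ᵥ φ)).re =
      ∑ k : TorusSite 2 L, ∑ σ : Fin 2, (star φ ⬝ᵥ (momentumNumber k σ *ᵥ φ)).re := by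
    intro φ
    rw [totalNumber_eq_sum_momentumNumber]
    simp only [sum_mulVec, dotProduct_sum, Complex.re_sum]
  have hsumτ : ∀ φ : Fock (Orb (FermionTorus 2 L)), ∑ k, ∑ σ, τ φ k σ =
      (star φ ⬝ᵥ (hubbardTorus 2 L 1 0 *ᵥ φ)).re - μ * (star φ ⬝ᵥ (totalNumber *ᵥ φ)).re -
        (∑ k : TorusSite 2 L, ∑ _σ : Fin 2, min (torusBand L k - μ) 0) * eucNorm φ ^ 2 := by
    intro φ
    rw [hH, hN, Finset.mul_sum, Finset.sum_mul, ← Finset.sum_sub_distrib, ← Finset.sum_sub_distrib]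
    refine Finset.sum_congr rfl fun k _ => ?_
    rw [Finset.mul_sum, Finset.sum_mul, ← Finset.sum_sub_distrib, ← Finset.sum_sub_distrib]
    refine Finset.sum_congr rfl fun σ _ => ?_
    simp only [hτ]
    ring
  -- particle number on the sector
  have hNsec : ∀ φ : Fock (Orb (FermionTorus 2 L)), IsInSector n n φ →
      (star φ ⬝ᵥ (totalNumber *ᵥ φ)).re = 2 * n * eucNorm φ ^ 2 := by
    intro φ hφ
    rw [totalNumber_mulVec_of_isNParticle hφ.isNParticle, dotProduct_smul, smul_eq_mul,
      star_dotProduct_self_eq_eucNorm_sq, ← Complex.ofReal_natCast, ← Complex.ofReal_mul, Complex.ofReal_re]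
    push_cast
    ring
  -- every slack vanishes on the aufbau vector
  have heΦ : eucNorm (Φ[l]) ^ 2 = 1 := by rw [eucNorm_sq, hΦ1, Complex.one_re]
  have hτΦ0 : ∀ k, τ (Φ[l]) k 0 = 0 := by
    intro k
    simp only [hτ, heΦ, mul_one]
    by_cases hk : k ∈ F
    · rw [momentumNumber_up_pairedState_of_mem ((hlmem k).2 hk), hΦ1, Complex.one_re, mul_one,
        min_eq_left (sub_nonpos.2 (hFS k hk)), sub_self]
    · have hge : μ ≤ torusBand L k := by
        by_contra h
        push Not at h
        exact hk (hBF k h)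
      rw [momentumNumber_up_pairedState_of_not_mem ((hlmem k).not.2 hk), dotProduct_zero, Complex.zero_re,
        mul_zero, min_eq_right (sub_nonneg.2 hge), sub_self]
  have hτΦ1 : ∀ k, τ (Φ[l]) k 1 = 0 := by
    intro k
    simp only [hτ, heΦ, mul_one]
    by_cases hk : -k ∈ F
    · have hle : torusBand L k ≤ μ := by
        have := hFS (-k) hk
        rwa [torusBand_neg] at this
      have hnk := momentumNumber_down_pairedState_of_mem ((hlmem (-k)).2 hk)
      rw [neg_neg] at hnk
      rw [hnk, hΦ1, Complex.one_re, mul_one,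
        min_eq_left (sub_nonpos.2 hle), sub_self]
    · have hge : μ ≤ torusBand L k := by
        by_contra h
        push Not at h
        exact hk (hBF (-k) (by rw [torusBand_neg]; exact h))
      have hnk := momentumNumber_down_pairedState_of_not_mem ((hlmem (-k)).not.2 hk)
      rw [neg_neg] at hnk
      rw [hnk, dotProduct_zero, Complex.zero_re,
        mul_zero, min_eq_right (sub_nonneg.2 hge), sub_self]
  have hτΦ : ∀ k σ, τ (Φ[l]) k σ = 0 := by
    intro k σ
    fin_cases σ
    · exact hτΦ0 k
    · exact hτΦ1 k
  -- hence `re⟨Φ, H₀ Φ⟩ = 2nμ + E₀(μ)`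
  have hEΦ : (star (Φ[l]) ⬝ᵥ (hubbardTorus 2 L 1 0 *ᵥ Φ[l])).re =
      μ * (2 * n) + ∑ k : TorusSite 2 L, ∑ _σ : Fin 2, min (torusBand L k - μ) 0 := by
    have h := hsumτ (Φ[l])
    rw [Finset.sum_eq_zero (fun k _ => Finset.sum_eq_zero fun σ _ => hτΦ k σ), hNsec _ hΦsec, heΦ] at h
    linarith
  -- minimality of the ground-state energy
  have hHerm : (hubbardTorus 2 L 1 0).IsHermitian :=
    (hamiltonian_isHermitian_and_commute_holds (fermionTorusGraph 2 L) 1 0).1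
  have hmin : (hubbardTorus 2 L 1 0).minEnergyOn (szSector (2 * n) 0) ≤
      (star (Φ[l]) ⬝ᵥ (hubbardTorus 2 L 1 0 *ᵥ Φ[l])).re :=
    minEnergyOn_le_rayleigh_of_mem hHerm _ hΦmem hΦ1
  have hEψ : (star ψ ⬝ᵥ (hubbardTorus 2 L 1 0 *ᵥ ψ)).re =
      (hubbardTorus 2 L 1 0).minEnergyOn (szSector (2 * n) 0) := by
    rw [hHψ, dotProduct_smul, hψ1, smul_eq_mul, mul_one, Complex.ofReal_re]
  have heψ : eucNorm ψ ^ 2 = 1 := by rw [eucNorm_sq, hψ1, Complex.one_re]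
  -- the slacks of `ψ` sum to `≤ 0`, hence vanish termwise
  have hsumψ : ∑ k, ∑ σ, τ ψ k σ ≤ 0 := by
    rw [hsumτ ψ, hNsec ψ hsec, heψ, hEψ]
    nlinarith [hmin, hEΦ]
  have hτψ0 : ∀ k σ, τ ψ k σ = 0 := by
    have hinner : ∀ k, 0 ≤ ∑ σ, τ ψ k σ := fun k => Finset.sum_nonneg fun σ _ => hτ_nonneg ψ k σ
    have htot : ∑ k, ∑ σ, τ ψ k σ = 0 :=
      le_antisymm hsumψ (Finset.sum_nonneg fun k _ => hinner k)
    intro k σ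
    have hk := (Finset.sum_eq_zero_iff_of_nonneg (fun k _ => hinner k)).1 htot k (mem_univ k)
    exact (Finset.sum_eq_zero_iff_of_nonneg (fun σ _ => hτ_nonneg ψ k σ)).1 hk σ (mem_univ σ)
  refine ⟨μ, fun k hk => ?_, fun k hk => ?_⟩
  · -- above `μ`: `(ε-μ)‖c_{k↑}ψ‖² = 0`
    have h0 := hτψ0 k 0
    simp only [hτ, min_eq_right (sub_nonneg.2 hk.le), zero_mul, sub_zero, re_expect_momentumNumber] at h0
    rcases mul_eq_zero.1 h0 with h | h
    · linarith
    · exact eq_zero_of_eucNorm_sq_eq_zero h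
  · -- below `μ`: `(μ-ε)‖c†_{k↑}ψ‖² = 0`
    have h0 := hτψ0 k 0
    have hid := eucNorm_sq_sub_re_expect_momentumNumber k 0 ψ
    simp only [hτ, min_eq_left (sub_neg.2 hk).le, heψ, mul_one] at h0
    have hprod : (torusBand L k - μ) * eucNorm (momentumCreation k 0 *ᵥ ψ) ^ 2 = 0 := by
      rw [← hid, heψ]
      linarith
    rcases mul_eq_zero.1 hprod with h | h
    · linarith
    · exact eq_zero_of_eucNorm_sq_eq_zero h

end Aufbau

/-! ## The free endpoint -/

section Endpoint

variable {L : ℕ} [NeZero L]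

/-- **The free torus has no `d`-wave pair order in ANY sector ground state.** For `L ≥ 3` and every
normalised ground state `ψ` of `hubbardTorus 2 L 1 0` in a sector `(2n, S^z = 0)`:
`re⟨ψ, P†P ψ⟩ ≤ 320 L²`, `P = pairField dWaveFormFactor L` (`= √2 Δ_d`). Since pair-field LRO asks for
`re⟨ψ, P†P ψ⟩ ≥ a L⁴`, no admissible sequence of the summit matrix at `U = 0` has it. [folklore] -/
theorem free_pairIntensity_le (hL : 3 ≤ L) (n : ℕ) (ψ : Fock (Orb (FermionTorus 2 L)))
    (hψ : IsGroundStateInSector (hubbardTorus 2 L 1 0) (2 * n) 0 ψ) (hψ1 : star ψ ⬝ᵥ ψ = 1) :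
    (Literature.MathematicalPhysics.QuantumLattice.expect
      ((pairField dWaveFormFactor L)ᴴ * pairField dWaveFormFactor L) ψ).re ≤ 320 * (L : ℝ) ^ 2 := by
  obtain ⟨μ, hA, hB⟩ := fermiStep_of_isGroundStateInSector hL hψ hψ1
  have h := re_expect_pairIntensity_le_of_fermiStep μ hψ1 hA hB
  have hlev : ((univ.filter fun k : TorusSite 2 L => torusBand L k = μ).card : ℝ) ≤ 2 * L := by
    exact_mod_cast card_levelSet_torusBand_le (L := L) μ
  have hc0 : (0:ℝ) ≤ ((univ.filter fun k : TorusSite 2 L => torusBand L k = μ).card : ℝ) := Nat.cast_nonneg _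
  have hc2 : ((univ.filter fun k : TorusSite 2 L => torusBand L k = μ).card : ℝ) ^ 2 ≤ (2 * (L:ℝ)) ^ 2 :=
    pow_le_pow_left₀ hc0 hlev 2
  calc _ ≤ 8 * (2 * (4 * (L : ℝ) ^ 2) +
        2 * (2 * ((univ.filter fun k : TorusSite 2 L => torusBand L k = μ).card : ℝ)) ^ 2) := h
    _ ≤ 320 * (L : ℝ) ^ 2 := by nlinarith [hc2]

end Endpoint

end Summit.HubbardSuperconductivity.CwThesis.Negative

end
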